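import Summits.Ventures.HSemireg.CocycleExtensionExact
import Literature.AlgebraicGeometry.Modules.RankOneCocycle
import HarnessLib

/-!
# Venture HSemireg — functoriality of the cocycle extension `ext w` (gs-g4 gen 21, brick C4a of
# `general-structure/COMPLEX-LEIBNIZ-PLAN-gs-g4.md`)

HONEST FRAMING. Sheaf algebra on an arbitrary scheme `X` with a unit `1`-cocycle `c` (only its cover `(U_x)_x` is
used). Sequel of `CocycleExtension.lean` / `CocycleExtensionExact.lean` (the glued extension
`0 → B → ext w → A → 0` of `A` by `B` along a local `1`-cocycle `w = (w_{xy} : A|_V → B|_V)`). Nothing about any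
variety; nothing here says HC, HC_CM or HC_AV is proved.

## Contents (everything proved)

* `LocalOneCocycle.precomp w f` — the pulled-back cocycle `(f| ≫ w_{xy})` along `f : A′ → A`; the zero cocycle
  (`Zero` instance, `zero_w`).
* **`CocycleExtension.map w w′ f g h : ext w ⟶ ext w′`** for `f : A → A′`, `g : B → B′` with
  `f| ≫ w′_{xy} = w_{xy} ≫ g|` — on sections `(a, (β_x)) ↦ (f a, (g β_x))`; its components (`fst_map_app`,
  `comp_map_app`), compatibility with `ι`, `π` and the local retractions `ret` (`ι_map`, `map_π`, `map_ret`),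
  `map_id`, `map_comp`, `map_eq_zero` (so that cocycle extensions of cochain complexes can be formed termwise).
* For the ZERO cocycle: the global retraction `ρ : ext 0 ⟶ B` (`(a, β) ↦ β`, glued from the `ret x`, which agree:
  `ret x - ret y = π ≫ 0`), `ι_ρ : ι ≫ ρ = 𝟙`, `restrictHom_ρ : ρ|_{U_x} = ret x`, and
  `map_zero_left : map 0 w′ 0 g _ = ρ ≫ g ≫ ι w′`.

## References

* [Har77] R. Hartshorne, *Algebraic Geometry*, GTM 52 (1977), II Ex. 1.22 (glueing sheaves), III.4 (Čech cochains).
-/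

noncomputable section

set_option backward.isDefEq.respectTransparency false

open CategoryTheory CategoryTheory.Limits AlgebraicGeometry TopologicalSpace Opposite

namespace Summit.Ventures.HSemireg

open Literature.AlgebraicGeometry.Modules Literature.AlgebraicGeometry.HodgeTheory CocycleTwist

universe u

variable {X : Scheme.{u}} {c : UnitCocycle X} {A B A' B' A'' B'' : X.Modules}

namespace LocalOneCocycle

variable (w : LocalOneCocycle c A B)

/-- **Pull-back of a local `1`-cocycle along `f : A′ → A`**: `(f|_V ≫ w_{xy,V})`. [folklore] -/
def precomp (f : A' ⟶ A) : LocalOneCocycle c A' B where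
  w x y V hx hy := (SheafOfModules.overFunctor _ V).map f ≫ w.w x y V hx hy
  restrictHom_w := by
    intro x y V W hx hy i
    rw [restrictHom_comp, restrictHom_over_map, w.restrictHom_w]
  w_cocycle x y z V hx hy hz := by rw [w.w_cocycle x y z V hx hy hz, Preadditive.comp_add]

/-- Components of the pulled-back cocycle. [folklore] -/
@[simp]
theorem precomp_w (f : A' ⟶ A) (x y : X) (V : X.Opens) (hx : V ≤ c.U x) (hy : V ≤ c.U y) :
    (w.precomp f).w x y V hx hy = (SheafOfModules.overFunctor _ V).map f ≫ w.w x y V hx hy := rfl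

variable (c A B) in
/-- The zero cocycle. [folklore] -/
def zero : LocalOneCocycle c A B where
  w _ _ _ _ _ := 0
  restrictHom_w := by
    intro x y V W hx hy i
    exact restrictHom_zero i
  w_cocycle _ _ _ _ _ _ _ := (add_zero _).symm

/-- `0` is the zero cocycle. [folklore] -/
instance : Zero (LocalOneCocycle c A B) := ⟨zero c A B⟩

/-- Components of the zero cocycle. [folklore] -/
@[simp]
theorem zero_w (x y : X) (V : X.Opens) (hx : V ≤ c.U x) (hy : V ≤ c.U y) :
    (0 : LocalOneCocycle c A B).w x y V hx hy = 0 := rfl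

end LocalOneCocycle

namespace CocycleExtension

variable (w : LocalOneCocycle c A B) (w' : LocalOneCocycle c A' B') (w'' : LocalOneCocycle c A'' B'')

/-! ### `map` -/

section Map

variable (f : A ⟶ A') (g : B ⟶ B')
  (h : ∀ (x y : X) (V : X.Opens) (hx : V ≤ c.U x) (hy : V ≤ c.U y),
    (SheafOfModules.overFunctor _ V).map f ≫ w'.w x y V hx hy = w.w x y V hx hy ≫ (SheafOfModules.overFunctor _ V).map g)

include h in
/-- The image family `(f a, (g β_x)_x)` of a section of `ext w` satisfies the relation of `w′`. [folklore] -/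
theorem mapFamily_mem {V : X.Opens} (s : Γ(ext w, V)) :
    ((f.app V (fst w s), fun x => g.app _ (comp w s x)) : PairFamily V) ∈ extFamilies w' V := by
  intro x y W hW hx hy
  change B'.presheaf.map _ (g.app _ (comp w s x)) - B'.presheaf.map _ (g.app _ (comp w s y)) =
    appLE _ _ (A'.presheaf.map _ (f.app V (fst w s)))
  rw [app_map_apply, app_map_apply, app_map_apply, ← map_sub, comp_rel w s x y hW hx hy, ← appLE_over_map f (𝟙 W),
    ← appLE_comp, h, appLE_comp, appLE_over_map]

/-- **Functoriality of the cocycle extension**: `map : ext w ⟶ ext w′`, `(a, (β_x)) ↦ (f a, (g β_x))`, for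
`f : A → A′`, `g : B → B′` intertwining the cocycles (`f| ≫ w′_{xy} = w_{xy} ≫ g|`). [cite: Hartshorne1977, II Ex. 1.22] -/
def map : ext w ⟶ ext w' :=
  homMk w' (fun V =>
    { toFun := fun s => mk w' _ (mapFamily_mem w w' f g h s)
      map_zero' := ext_ext w' (by simp) fun x => by simp
      map_add' := fun s t => ext_ext w' (by simp) fun x => by simp })
    (fun V W hWV s => by simp [app_map_apply])
    (fun V W hWV s x => by simp [app_map_apply])
    (fun V a s => by
      simp only [AddMonoidHom.coe_mk, ZeroHom.coe_mk, fst_mk, fst_smul]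
      exact Scheme.Modules.Hom.app_smul f a _)
    (fun V a s x => by
      simp only [AddMonoidHom.coe_mk, ZeroHom.coe_mk, comp_mk, comp_smul]
      exact Scheme.Modules.Hom.app_smul g _ _)

/-- `A′`-component of `map`. [folklore] -/
@[simp]
theorem fst_map_app {V : X.Opens} (s : Γ(ext w, V)) : fst w' ((map w w' f g h).app V s) = f.app V (fst w s) := rfl

/-- Point components of `map`. [folklore] -/
@[simp]
theorem comp_map_app {V : X.Opens} (s : Γ(ext w, V)) (x : X) :
    comp w' ((map w w' f g h).app V s) x = g.app _ (comp w s x) := rfl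

/-- **`ι ≫ map = g ≫ ι′`.** [folklore] -/
theorem ι_map : ι w ≫ map w w' f g h = g ≫ ι w' := by
  refine Scheme.Modules.hom_ext _ _ fun V => AddCommGrpCat.ext fun b => ?_
  change (map w w' f g h).app V ((ι w).app V b) = (ι w').app V (g.app V b)
  refine ext_ext w' ?_ fun x => ?_
  · rw [fst_map_app, fst_ι_app, fst_ι_app, map_zero]
  · rw [comp_map_app, comp_ι_app, comp_ι_app, app_map_apply]

/-- **`map ≫ π′ = π ≫ f`.** [folklore] -/
theorem map_π : map w w' f g h ≫ π w' = π w ≫ f := by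
  refine Scheme.Modules.hom_ext _ _ fun V => AddCommGrpCat.ext fun s => ?_
  change (π w').app V ((map w w' f g h).app V s) = f.app V ((π w).app V s)
  rw [π_app_apply, fst_map_app, π_app_apply]

/-- **`map| ≫ ret′ z = ret z ≫ g|`** over `U_z`: `map` intertwines the local retractions. [folklore] -/
theorem map_ret (z : X) :
    (SheafOfModules.overFunctor _ (c.U z)).map (map w w' f g h) ≫ ret w' z =
      ret w z ≫ (SheafOfModules.overFunctor _ (c.U z)).map g := by
  refine hom_ext_of_appLE fun V k (s : Γ(ext w, V)) => ?_
  rw [appLE_comp, appLE_comp, appLE_over_map, appLE_ret, comp_map_app, appLE_over_map, appLE_ret, app_map_apply]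

end Map

/-- `map` does not depend on the names of the morphisms (congruence in `f`, `g`). [folklore] -/
theorem map_congr {f f' : A ⟶ A'} {g g' : B ⟶ B'} (hf : f = f') (hg : g = g') (h h') :
    map w w' f g h = map w w' f' g' h' := by
  subst hf hg
  rfl

/-- **`map 𝟙 𝟙 = 𝟙`.** [folklore] -/
theorem map_id (h) : map w w (𝟙 A) (𝟙 B) h = 𝟙 (ext w) :=
  Scheme.Modules.hom_ext _ _ fun _ => AddCommGrpCat.ext fun _ => ext_ext w rfl fun _ => rfl

/-- **`map (f, g) ≫ map (f′, g′) = map (f ≫ f′, g ≫ g′)`.** [folklore] -/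
theorem map_comp (f : A ⟶ A') (g : B ⟶ B') (f' : A' ⟶ A'') (g' : B' ⟶ B'') (h h' h'') :
    map w w' f g h ≫ map w' w'' f' g' h' = map w w'' (f ≫ f') (g ≫ g') h'' :=
  Scheme.Modules.hom_ext _ _ fun _ => AddCommGrpCat.ext fun _ => ext_ext w'' rfl fun _ => rfl

/-- `map 0 0 = 0`. [folklore] -/
theorem map_eq_zero {f : A ⟶ A'} {g : B ⟶ B'} (hf : f = 0) (hg : g = 0) (h) : map w w' f g h = 0 := by
  subst hf hg
  refine Scheme.Modules.hom_ext _ _ fun V => AddCommGrpCat.ext fun s => ?_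
  change (map w w' 0 0 h).app V s = (0 : ext w ⟶ ext w').app V s
  rw [Scheme.Modules.Hom.zero_app]
  refine ext_ext w' ?_ fun x => ?_
  · rw [fst_map_app, Scheme.Modules.Hom.zero_app]; rfl
  · rw [comp_map_app, Scheme.Modules.Hom.zero_app]; rfl

/-- The compatibility hypothesis of `map` holds trivially between zero cocycles... and, usefully, it is closed
under composition: if `(f, g)` intertwines `w, w′` and `(f′, g′)` intertwines `w′, w″` then `(f ≫ f′, g ≫ g′)`
intertwines `w, w″`. [folklore] -/
theorem compat_comp {f : A ⟶ A'} {g : B ⟶ B'} {f' : A' ⟶ A''} {g' : B' ⟶ B''}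
    (h : ∀ (x y : X) (V : X.Opens) (hx : V ≤ c.U x) (hy : V ≤ c.U y),
      (SheafOfModules.overFunctor _ V).map f ≫ w'.w x y V hx hy = w.w x y V hx hy ≫ (SheafOfModules.overFunctor _ V).map g)
    (h' : ∀ (x y : X) (V : X.Opens) (hx : V ≤ c.U x) (hy : V ≤ c.U y),
      (SheafOfModules.overFunctor _ V).map f' ≫ w''.w x y V hx hy =
        w'.w x y V hx hy ≫ (SheafOfModules.overFunctor _ V).map g')
    (x y : X) (V : X.Opens) (hx : V ≤ c.U x) (hy : V ≤ c.U y) :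
    (SheafOfModules.overFunctor _ V).map (f ≫ f') ≫ w''.w x y V hx hy =
      w.w x y V hx hy ≫ (SheafOfModules.overFunctor _ V).map (g ≫ g') := by
  rw [Functor.map_comp, Functor.map_comp, Category.assoc, h', ← Category.assoc, h, Category.assoc]

/-- The compatibility hypothesis for zero morphisms. [folklore] -/
theorem compat_zero (x y : X) (V : X.Opens) (hx : V ≤ c.U x) (hy : V ≤ c.U y) :
    (SheafOfModules.overFunctor _ V).map (0 : A ⟶ A') ≫ w'.w x y V hx hy =
      w.w x y V hx hy ≫ (SheafOfModules.overFunctor _ V).map (0 : B ⟶ B') := by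
  have h1 : (SheafOfModules.overFunctor _ V).map (0 : A ⟶ A') = 0 :=
    hom_ext_of_appLE fun W k s => by rw [appLE_over_map, appLE_zero, Scheme.Modules.Hom.zero_app]; rfl
  have h2 : (SheafOfModules.overFunctor _ V).map (0 : B ⟶ B') = 0 :=
    hom_ext_of_appLE fun W k s => by rw [appLE_over_map, appLE_zero, Scheme.Modules.Hom.zero_app]; rfl
  rw [h1, h2, zero_comp, Limits.comp_zero]

/-! ### The zero cocycle: the global retraction `ρ` -/

section ZeroCocycle

variable (A B)

/-- For the zero cocycle the local retractions agree on overlaps (`ret x - ret y = π ≫ 0 = 0`). [folklore] -/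
theorem ret_zero_compatible (x y : X) :
    restrictHom (Opens.infLELeft (c.U x) (c.U y)) (ret (0 : LocalOneCocycle c A B) x) =
      restrictHom (Opens.infLERight (c.U x) (c.U y)) (ret (0 : LocalOneCocycle c A B) y) := by
  have h := ret_sub_ret (0 : LocalOneCocycle c A B) x y (V := c.U x ⊓ c.U y) inf_le_left inf_le_right
  rw [LocalOneCocycle.zero_w, Limits.comp_zero, sub_eq_zero] at h
  rw [Subsingleton.elim (Opens.infLELeft (c.U x) (c.U y)) (homOfLE inf_le_left),
    Subsingleton.elim (Opens.infLERight (c.U x) (c.U y)) (homOfLE inf_le_right)]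
  exact h

/-- **The global retraction `ρ : ext 0 ⟶ B`** of the split extension along the zero cocycle, `(a, β) ↦ β`
(glued from the local retractions over the cover `(U_x)`, `Modules/SheafHom.glueHom` + `homOfOverCover`). [folklore] -/
def ρ : ext (0 : LocalOneCocycle c A B) ⟶ B :=
  homOfOverCover c.mem (glueHom c.U (fun x => ret (0 : LocalOneCocycle c A B) x) (ret_zero_compatible A B))

/-- Values of `ρ` over `V ⊆ U_z`: those of `ret z`. [folklore] -/
theorem ρ_app (z : X) {V : X.Opens} (hV : V ≤ c.U z) (s : Γ(ext (0 : LocalOneCocycle c A B), V)) :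
    (ρ A B).app V s = appLE (ret (0 : LocalOneCocycle c A B) z) (homOfLE hV) s := by
  rw [ρ, homOfOverCover_app, appLE_glueHom]
  exact glueValue_eq_appLE c.U _ (ret_zero_compatible A B) z (homOfLE hV) _ s

/-- **`ρ|_{U_z} = ret z`.** [folklore] -/
theorem restrictHom_ρ (z : X) :
    (SheafOfModules.overFunctor _ (c.U z)).map (ρ A B) = ret (0 : LocalOneCocycle c A B) z := by
  refine hom_ext_of_appLE fun V k s => ?_
  rw [appLE_over_map, ρ_app A B z k.le]
  exact appLE_congr_hom _ _ _ _

/-- **`ι ≫ ρ = 𝟙`.** [folklore] -/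
theorem ι_ρ : ι (0 : LocalOneCocycle c A B) ≫ ρ A B = 𝟙 B := by
  refine Scheme.Modules.hom_ext _ _ fun V => ?_
  ext b
  change (ρ A B).app V ((ι (0 : LocalOneCocycle c A B)).app V b) = b
  have hcov : V ≤ ⨆ x : X, V ⊓ c.U x := fun v hv => Opens.mem_iSup.mpr ⟨v, ⟨hv, c.mem v⟩⟩
  refine TopCat.Sheaf.eq_of_locally_eq' (⟨B.presheaf, Scheme.Modules.isSheaf B⟩ : TopCat.Sheaf Ab X)
    (fun x : X => V ⊓ c.U x) V (fun x => homOfLE inf_le_left) hcov _ _ fun x => ?_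
  change B.presheaf.map _ _ = B.presheaf.map _ _
  rw [app_map_apply, app_map_apply, ρ_app A B x (inf_le_right : V ⊓ c.U x ≤ c.U x),
    ← appLE_over_map (U := c.U x) (ι _) (homOfLE (inf_le_right : V ⊓ c.U x ≤ c.U x)), ← appLE_comp, ι_comp_ret,
    appLE_id]

variable {A B}

/-- **`map` out of the split extension with zero `A`-part**: `map 0 w′ 0 g = ρ ≫ g ≫ ι′`
(`(a, β) ↦ (0, (g β)_x)`). [folklore] -/
theorem map_zero_left (g : B ⟶ B') (h) :
    map (0 : LocalOneCocycle c A B) w' (0 : A ⟶ A') g h = ρ A B ≫ g ≫ ι w' := by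
  refine Scheme.Modules.hom_ext _ _ fun V => AddCommGrpCat.ext fun s => ?_
  change (map 0 w' 0 g h).app V s = (ι w').app V (g.app V ((ρ A B).app V s))
  refine ext_ext w' ?_ fun x => ?_
  · rw [fst_map_app, fst_ι_app, Scheme.Modules.Hom.zero_app]; rfl
  · rw [comp_map_app, comp_ι_app, app_map_apply g, app_map_apply (ρ A B),
      ρ_app A B x (inf_le_right : V ⊓ c.U x ≤ c.U x), appLE_ret, comp_map, presheaf_map_map]
    congr 1
    exact ((presheaf_map_congr B _ (𝟙 _) _).trans (presheaf_map_id_apply B _ _)).symm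

end ZeroCocycle

end CocycleExtension

end Summit.Ventures.HSemireg

end
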